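import Literature.MathematicalPhysics.QuantumFieldTheory.ConformalBootstrap3D.FreeScalarBlockDecomposition
import Literature.MathematicalPhysics.QuantumFieldTheory.ConformalBootstrap3D.SingleCorrelatorCertificate
import Mathlib.Tactic
import HarnessLib

/-!
# Non-vacuity of the single-correlator hypothesis set: the free scalar witness

Every single-correlator certificate of the tree (`SingleCorrelatorCertificate`, `PointCertificate…`,
`PointKernel…`) proves `BoxExcluded Q` — "no `σ–ε` datum satisfying the typed axioms A1–A4
(`SatisfiesBootstrapAxioms`) has `(Δ_σ, Δ_ε) ∈ Q`" — but USES only the `⟨σσσσ⟩` part of the axioms: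
genuine even-sector blocks (A2), unitarity bounds and even spins (A1), sum rule 1 (A3) and the scalar gap
`Δ_ε' ≥ 3` in `σ × σ` (A4(b)). A statement of the form `∀ D, Hyp D → …` is only as good as `Hyp` is
consistent, and for the full typed axiom set no model has been exhibited in the tree (a consistency
witness needs the mixed-correlator decomposition of a generalised free field with `Δ_φ ≥ 1` — the odd-sector
gap A4(a) puts `φ³ ∈ φ × φ²` at `3Δ_φ ≥ 3`, while A4(b) alone, `φ⁴ ∈ φ² × φ²` at `4Δ_φ ≥ 3`, would need only
`Δ_φ ≥ 3/4` (REFEREE F95); the A3 sign erratum of 2026-08-19 shows the risk is real). This file closes the gap for the single-correlator results: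

* `SigmaEpsilonData.SatisfiesSigmaAxioms` — the `⟨σσσσ⟩` projection of A1–A4, implied by
  `SatisfiesBootstrapAxioms` (`SatisfiesBootstrapAxioms.sigmaAxioms`);
* `SigmaBoxExcluded Q := ∀ D, D.SatisfiesSigmaAxioms → (D.Δσ, D.Δε) ∉ Q`, which implies `BoxExcluded Q`
  (`SigmaBoxExcluded.boxExcluded`);
* `sigmaBoxExcluded_of_evaluationContinuous`, `SingleCorrelatorObligations.sigmaBoxExcluded` — the
  single-correlator functional argument (Rattazzi–Rychkov–Tonni–Vichi 2008 §5; Kos–Poland–Simmons-Duffin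
  2014 eq. (3.16), first line) proves the STRONGER statement `SigmaBoxExcluded Q` from exactly the
  obligations (O1)–(O5) the certificates discharge;
* `freeScalarData`, `freeScalarData_satisfiesSigmaAxioms` — **the free massless scalar
  `(Δ_σ, Δ_ε) = (1/2, 1)` satisfies `SatisfiesSigmaAxioms`**: blocks `hrBlock (2m+1) (2m)` (typed blocks by
  `IsAdmissible3D.isConformalBlock3D_hrBlock`), coefficients `λ²_{2m} = freeScalarOPECoeffSq m > 0`, sum
  rule 1 from the PROVED decomposition `𝒢 - 1 = Σ_m λ²_{2m} g_{2m+1,2m}` (`FreeScalarBlockDecomposition`)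
  at `(z, z̄)` and at `(1-z, 1-z̄)`, the only scalar being `φ²` at `Δ = 1 = Δ_ε`;
* `SigmaBoxExcluded.half_one_not_mem` — consequently the hypothesis class of every single-correlator
  certificate is NON-EMPTY, and no certificate of this shape can exclude a box containing `(1/2, 1)`
  (the free point lies on the boundary of the single-correlator allowed region, El-Showk et al. 2012 §5,
  Fig. 3: the bound starts at the free theory).

References: R. Rattazzi, V. S. Rychkov, E. Tonni, A. Vichi, JHEP 12 (2008) 031, §5
[cite: RattazziEtAl2008, §5]; F. Kos, D. Poland, D. Simmons-Duffin, JHEP 11 (2014) 109, §3.3 eq. (3.16)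
[cite: KosPolandSimmonsduffin2014, §3.3 eq. (3.16)]; S. El-Showk, M. F. Paulos, D. Poland, S. Rychkov,
D. Simmons-Duffin, A. Vichi, Phys. Rev. D 86 (2012) 025022, §5 [cite: ElShowkEtAl2012, §5];
A. L. Fitzpatrick, J. Kaplan, JHEP 10 (2012) 032, §2.2 [cite: FitzpatrickKaplan2012, §2.2].
-/

namespace Literature.MathematicalPhysics.QuantumFieldTheory.ConformalBootstrap3D

open Set

namespace SigmaEpsilonData

/-- **The single-correlator (`⟨σσσσ⟩`) part of the typed axioms A1–A4**: genuine even-sector blocks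
`gp i = g^{0,0}_{Δp i, ℓp i}` (A2), `Δ_σ, Δ_ε ≥ 1/2`, unitarity bounds and even spins for the `𝒪⁺`
(A1), diagonal convergence of `Σ λ²_{σσ𝒪} g_𝒪(x,x)` (A1, convergence clause), sum rule 1 (A3) and the gap
"every scalar of `σ × σ` below `3` is `ε`" (A4(b)) — exactly the hypotheses a functional acting on sum
rule 1 uses (Rattazzi–Rychkov–Tonni–Vichi 2008 §5, inside the `σ–ε` system). [cite: RattazziEtAl2008, §5] -/
def SatisfiesSigmaAxioms (D : SigmaEpsilonData) : Prop :=
  (∀ i, IsConformalBlock3D 0 0 (D.Δp i) (D.ℓp i) (D.gp i)) ∧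
    (1 / 2 ≤ D.Δσ ∧ 1 / 2 ≤ D.Δε ∧ (∀ i, unitarityBound3D (D.ℓp i) ≤ D.Δp i) ∧ ∀ i, Even (D.ℓp i)) ∧
      (∀ x : ℝ, 0 < x → x < 1 → Summable (fun i => D.lamσσ i ^ 2 * D.gp i x x)) ∧
        (∀ z zb : ℝ, z ∈ Ioo (0 : ℝ) 1 → zb ∈ Ioo (0 : ℝ) 1 →
          HasSum (fun i => D.lamσσ i ^ 2 * crossF D.Δσ (-1) (D.gp i) z zb)
            (-(crossF D.Δσ (-1) (fun _ _ => 1) z zb))) ∧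
          ∀ i, D.ℓp i = 0 → D.Δp i < 3 → D.Δp i = D.Δε

/-- The typed axioms A1–A4 imply their single-correlator part. Elementary (projections). [folklore] -/
theorem SatisfiesBootstrapAxioms.sigmaAxioms {D : SigmaEpsilonData} (h : D.SatisfiesBootstrapAxioms) :
    D.SatisfiesSigmaAxioms :=
  ⟨h.1.1, ⟨h.2.1.1, h.2.1.2.1, h.2.1.2.2.1, h.2.1.2.2.2.1⟩, fun x hx0 hx1 => (h.2.2.1 x hx0 hx1).1,
    fun z zb hz hzb => (h.2.2.2.1 z zb hz hzb).1, h.2.2.2.2.2⟩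

end SigmaEpsilonData

/-- A box `Q` of `(Δ_σ, Δ_ε)` is **σ-excluded** if no datum satisfying the single-correlator axioms has
`(Δ_σ, Δ_ε) ∈ Q` — exclusion over the LARGER hypothesis class `SatisfiesSigmaAxioms ⊇ SatisfiesBootstrapAxioms`.
[cite: RattazziEtAl2008, §5] -/
def SigmaBoxExcluded (Q : Set (ℝ × ℝ)) : Prop :=
  ∀ D : SigmaEpsilonData, D.SatisfiesSigmaAxioms → (D.Δσ, D.Δε) ∉ Q

/-- σ-exclusion implies exclusion (`BoxExcluded`, over `SatisfiesBootstrapAxioms`). Elementary. [folklore] -/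
theorem SigmaBoxExcluded.boxExcluded {Q : Set (ℝ × ℝ)} (h : SigmaBoxExcluded Q) : BoxExcluded Q :=
  fun D hD => h D hD.sigmaAxioms

/-- Monotonicity in the box. Elementary. [folklore] -/
theorem SigmaBoxExcluded.mono {Q Q' : Set (ℝ × ℝ)} (h : SigmaBoxExcluded Q) (hQ' : Q' ⊆ Q) :
    SigmaBoxExcluded Q' :=
  fun D hD hmem => h D hD (hQ' hmem)

/-- Two σ-excluded boxes have a σ-excluded union. Elementary. [folklore] -/
theorem SigmaBoxExcluded.union {Q Q' : Set (ℝ × ℝ)} (h : SigmaBoxExcluded Q) (h' : SigmaBoxExcluded Q') :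
    SigmaBoxExcluded (Q ∪ Q') :=
  fun D hD hmem => hmem.elim (h D hD) (h' D hD)

/-- **The single-correlator functional argument proves σ-exclusion.** An evaluation-continuous linear
functional `φ` with `φ[F_{-,𝟙}] > 0` on `Q` and `φ[F_{-,Δ,ℓ}[g]] ≥ 0` for every typed block allowed in
`σ × σ` (even `ℓ`, unitarity bound, scalars below `3` only at `Δ_ε`) excludes `Q` over `SatisfiesSigmaAxioms`:
apply `φ` termwise to sum rule 1, `0 ≤ Σ λ² φ[F_𝒪] = -φ[F_𝟙] < 0`. (Rattazzi–Rychkov–Tonni–Vichi 2008 §5;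
Kos–Poland–Simmons-Duffin 2014 eq. (3.16), first line.) [cite: KosPolandSimmonsduffin2014, §3.3 eq. (3.16)] -/
theorem sigmaBoxExcluded_of_evaluationContinuous {φ : (ℝ → ℝ → ℝ) →ₗ[ℝ] ℝ} (hφ : EvaluationContinuous φ)
    (Q : Set (ℝ × ℝ)) (hI : ∀ p ∈ Q, 0 < φ (crossF p.1 (-1) (fun _ _ => (1 : ℝ))))
    (hpos : ∀ p ∈ Q, ∀ (Δ : ℝ) (ℓ : ℕ) (g : ℝ → ℝ → ℝ), Even ℓ → unitarityBound3D ℓ ≤ Δ →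
      (ℓ = 0 → Δ < 3 → Δ = p.2) → IsConformalBlock3D 0 0 Δ ℓ g → 0 ≤ φ (crossF p.1 (-1) g)) :
    SigmaBoxExcluded Q := by
  intro D hD hmem
  obtain ⟨hblk, ⟨_, _, hub, heven⟩, _, hcross, hgap⟩ := hD
  have hsum := hφ.hasSum_mul (fun i => D.lamσσ i ^ 2) (fun i => crossF D.Δσ (-1) (D.gp i))
    (fun z zb => -(crossF D.Δσ (-1) (fun _ _ => 1) z zb)) (fun z zb hz hzb => hcross z zb hz hzb)
  have hfun : (fun z zb : ℝ => -(crossF D.Δσ (-1) (fun _ _ => (1 : ℝ)) z zb)) =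
      -(crossF D.Δσ (-1) (fun _ _ => (1 : ℝ))) := by
    funext z zb
    rfl
  have hneg : φ (fun z zb : ℝ => -(crossF D.Δσ (-1) (fun _ _ => (1 : ℝ)) z zb)) =
      -φ (crossF D.Δσ (-1) (fun _ _ => (1 : ℝ))) := by
    rw [hfun, map_neg]
  have hnn : ∀ i, 0 ≤ D.lamσσ i ^ 2 * φ (crossF D.Δσ (-1) (D.gp i)) := fun i =>
    mul_nonneg (sq_nonneg _) (hpos (D.Δσ, D.Δε) hmem (D.Δp i) (D.ℓp i) (D.gp i) (heven i) (hub i)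
      (hgap i) (hblk i))
  have h0 := hsum.nonneg hnn
  rw [hneg] at h0
  linarith [hI (D.Δσ, D.Δε) hmem]

namespace SingleCorrelatorObligations

/-- **A discharged obligation list proves σ-exclusion** (the stronger conclusion of
`SingleCorrelatorObligations.boxExcluded`, from the same obligations (O1)–(O5)).
[cite: KosPolandSimmonsduffin2014, §3.3 eq. (3.16)] -/
theorem sigmaBoxExcluded {n : ℕ} {w z zb : Fin n → ℝ} (hz : ∀ k, z k ∈ Ioo (0 : ℝ) 1)
    (hzb : ∀ k, zb k ∈ Ioo (0 : ℝ) 1) {Q : Set (ℝ × ℝ)} {Δstar : ℝ}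
    (h : SingleCorrelatorObligations (pointFunctional w z zb) Q Δstar) : SigmaBoxExcluded Q :=
  sigmaBoxExcluded_of_evaluationContinuous (evaluationContinuous_pointFunctional w z zb hz hzb) Q
    h.identity_pos h.nonneg

end SingleCorrelatorObligations

/-! ### The free scalar witness -/

/-- **The free massless scalar as a `σ–ε` datum**: `σ = φ` (`Δ_σ = 1/2`), `ε = φ²` (`Δ_ε = 1`); the even
sector of `φ × φ` indexed by `m : ℕ` — `φ²` (`m = 0`: `Δ = 1`, `ℓ = 0`) and the conserved currents
`J_{2m}` (`Δ = 2m + 1`, `ℓ = 2m`, `m ≥ 1`), blocks `hrBlock (2m+1) (2m)`, coefficients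
`λ_{σσ𝒪} = √(freeScalarOPECoeffSq m)`; `λ_{εε𝒪} := 0` and an empty odd sector (these fields are not
constrained by `SatisfiesSigmaAxioms`). [cite: FitzpatrickKaplan2012, §2.2] -/
noncomputable def freeScalarData : SigmaEpsilonData where
  Δσ := 1 / 2
  Δε := 1
  ιp := ℕ
  Δp := fun m => 2 * (m : ℝ) + 1
  ℓp := fun m => 2 * m
  lamσσ := fun m => Real.sqrt (freeScalarOPECoeffSq m)
  lamεε := fun _ => 0
  gp := fun m => hrBlock (2 * (m : ℝ) + 1) (2 * m)
  ιm := Empty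
  Δm := fun e => e.elim
  ℓm := fun e => e.elim
  lamσε := fun e => e.elim
  gmm := fun e => e.elim
  gpm := fun e => e.elim

/-- Unfolding: `Δ_σ = 1/2`. [folklore] -/
@[simp] theorem freeScalarData_Δσ : freeScalarData.Δσ = 1 / 2 := rfl

/-- Unfolding: `Δ_ε = 1`. [folklore] -/
@[simp] theorem freeScalarData_Δε : freeScalarData.Δε = 1 := rfl

/-- Unfolding: `Δ(J_{2m}) = 2m + 1`. [folklore] -/
theorem freeScalarData_Δp (m : ℕ) : freeScalarData.Δp m = 2 * (m : ℝ) + 1 := rfl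

/-- Unfolding: `ℓ(J_{2m}) = 2m`. [folklore] -/
theorem freeScalarData_ℓp (m : ℕ) : freeScalarData.ℓp m = 2 * m := rfl

/-- Unfolding: `λ_{σσJ_{2m}} = √(λ²_{2m})`. [folklore] -/
theorem freeScalarData_lamσσ (m : ℕ) :
    freeScalarData.lamσσ m = Real.sqrt (freeScalarOPECoeffSq m) := rfl

/-- Unfolding: the block of `J_{2m}` is `hrBlock (2m+1) (2m)`. [folklore] -/
theorem freeScalarData_gp (m : ℕ) : freeScalarData.gp m = hrBlock (2 * (m : ℝ) + 1) (2 * m) := rfl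

/-- The points `(2m+1, 2m)` are admissible (`φ²` strictly above the scalar bound `1/2`; the currents at the
bound `ℓ + 1`, `ℓ ≥ 2`). [folklore] -/
theorem isAdmissible3D_freeScalar (m : ℕ) : IsAdmissible3D (2 * (m : ℝ) + 1) (2 * m) := by
  refine ⟨?_, ?_⟩
  · unfold unitarityBound3D
    split_ifs with h
    · have : (0 : ℝ) ≤ (m : ℝ) := Nat.cast_nonneg m
      linarith
    · push_cast
      exact le_rfl
  · intro h
    have hm : m = 0 := by omega
    subst hm
    simp [unitarityBound3D]
    norm_num

/-- **Sum rule 1 for the free scalar**: `Σ_m λ²_{2m} F_{-,2m+1,2m}(z,z̄) = -F_{-,𝟙}(z,z̄)` on the open square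
— the decomposition `FreeScalarBlockDecomposition.hasSum_freeScalar_blocks` at `(z,z̄)` and at `(1-z,1-z̄)`
and `v^{1/2} 𝒢₁(z,z̄) - u^{1/2} 𝒢₁(1-z,1-z̄) = u^{1/2} - v^{1/2}` for `𝒢₁ = u^{1/2}(1 + v^{-1/2})`.
[cite: FitzpatrickKaplan2012, §2.2] -/
theorem hasSum_freeScalar_crossing {z zb : ℝ} (hz : z ∈ Ioo (0 : ℝ) 1) (hzb : zb ∈ Ioo (0 : ℝ) 1) :
    HasSum (fun m : ℕ => freeScalarOPECoeffSq m *
        crossF (1 / 2) (-1) (hrBlock (2 * (m : ℝ) + 1) (2 * m)) z zb)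
      (-(crossF (1 / 2) (-1) (fun _ _ => (1 : ℝ)) z zb)) := by
  have hz' : 1 - z ∈ Ioo (0 : ℝ) 1 := ⟨by linarith [hz.2], by linarith [hz.1]⟩
  have hzb' : 1 - zb ∈ Ioo (0 : ℝ) 1 := ⟨by linarith [hzb.2], by linarith [hzb.1]⟩
  have h1 := hasSum_freeScalar_blocks hz hzb
  have h2 := hasSum_freeScalar_blocks hz' hzb'
  have h := (h1.mul_left (((1 - z) * (1 - zb)) ^ ((1 : ℝ) / 2))).add
    ((h2.mul_left ((z * zb) ^ ((1 : ℝ) / 2))).mul_left (-1))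
  have hfun : (fun m : ℕ => freeScalarOPECoeffSq m *
      crossF (1 / 2) (-1) (hrBlock (2 * (m : ℝ) + 1) (2 * m)) z zb) =
      fun m => ((1 - z) * (1 - zb)) ^ ((1 : ℝ) / 2) *
          (freeScalarOPECoeffSq m * hrBlock (2 * (m : ℝ) + 1) (2 * m) z zb) +
        -1 * ((z * zb) ^ ((1 : ℝ) / 2) *
          (freeScalarOPECoeffSq m * hrBlock (2 * (m : ℝ) + 1) (2 * m) (1 - z) (1 - zb))) := by
    funext m
    unfold crossF
    ring
  have hu : 0 < (z * zb) ^ ((1 : ℝ) / 2) := Real.rpow_pos_of_pos (mul_pos hz.1 hzb.1) _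
  have hv : 0 < ((1 - z) * (1 - zb)) ^ ((1 : ℝ) / 2) := Real.rpow_pos_of_pos (mul_pos hz'.1 hzb'.1) _
  have hval : -(crossF (1 / 2) (-1) (fun _ _ => (1 : ℝ)) z zb) =
      ((1 - z) * (1 - zb)) ^ ((1 : ℝ) / 2) * freeScalarCorrelator z zb +
        -1 * ((z * zb) ^ ((1 : ℝ) / 2) * freeScalarCorrelator (1 - z) (1 - zb)) := by
    unfold crossF freeScalarCorrelator
    rw [sub_sub_cancel, sub_sub_cancel]
    field_simp
    ring
  rw [hfun, hval]
  exact h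

/-- **The free scalar satisfies the single-correlator axioms** at `(Δ_σ, Δ_ε) = (1/2, 1)`.
[cite: FitzpatrickKaplan2012, §2.2] -/
theorem freeScalarData_satisfiesSigmaAxioms : freeScalarData.SatisfiesSigmaAxioms := by
  refine ⟨fun m => (isAdmissible3D_freeScalar m).isConformalBlock3D_hrBlock,
    ⟨le_rfl, by norm_num [freeScalarData_Δε], fun m => (isAdmissible3D_freeScalar m).1,
      fun m => ?_⟩, ?_, ?_, ?_⟩
  · change ℕ at m
    exact even_two_mul m
  · intro x hx0 hx1
    simp only [freeScalarData_lamσσ, freeScalarData_gp, Real.sq_sqrt (freeScalarOPECoeffSq_pos _).le]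
    exact summable_freeScalar_blocks_diag hx0 hx1
  · intro z zb hz hzb
    simp only [freeScalarData_lamσσ, freeScalarData_gp, freeScalarData_Δσ,
      Real.sq_sqrt (freeScalarOPECoeffSq_pos _).le]
    exact hasSum_freeScalar_crossing hz hzb
  · intro m h0 _
    change ℕ at m
    have hm : m = 0 := by
      rw [freeScalarData_ℓp] at h0
      omega
    subst hm
    rw [freeScalarData_Δp, freeScalarData_Δε]
    norm_num

/-- **The single-correlator hypothesis class is non-empty**, with a member at `(Δ_σ, Δ_ε) = (1/2, 1)`.
[cite: FitzpatrickKaplan2012, §2.2] -/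
theorem exists_satisfiesSigmaAxioms :
    ∃ D : SigmaEpsilonData, D.SatisfiesSigmaAxioms ∧ D.Δσ = 1 / 2 ∧ D.Δε = 1 :=
  ⟨freeScalarData, freeScalarData_satisfiesSigmaAxioms, rfl, rfl⟩

/-- **No σ-excluded box contains the free point `(1/2, 1)`.** In particular no single-correlator
certificate (`SingleCorrelatorObligations`, and every `PointCertificate…` schema, all of which factor through
it) can exclude a box containing `(1/2, 1)`: their hypothesis class is realised there. (The free theory lies
on the boundary of the single-correlator allowed region: El-Showk et al. 2012, §5.) [cite: ElShowkEtAl2012, §5] -/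
theorem SigmaBoxExcluded.half_one_not_mem {Q : Set (ℝ × ℝ)} (h : SigmaBoxExcluded Q) :
    ((1 : ℝ) / 2, (1 : ℝ)) ∉ Q :=
  h freeScalarData freeScalarData_satisfiesSigmaAxioms

/-- The same for a discharged single-correlator obligation list. [cite: ElShowkEtAl2012, §5] -/
theorem SingleCorrelatorObligations.half_one_not_mem {n : ℕ} {w z zb : Fin n → ℝ}
    (hz : ∀ k, z k ∈ Ioo (0 : ℝ) 1) (hzb : ∀ k, zb k ∈ Ioo (0 : ℝ) 1) {Q : Set (ℝ × ℝ)} {Δstar : ℝ}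
    (h : SingleCorrelatorObligations (pointFunctional w z zb) Q Δstar) : ((1 : ℝ) / 2, (1 : ℝ)) ∉ Q :=
  (h.sigmaBoxExcluded hz hzb).half_one_not_mem

/-! ### σ-enclosures: the windowed statement over the non-empty class -/

/-- **σ-enclosure**: every datum satisfying the single-correlator axioms whose `(Δ_σ, Δ_ε)` lies in the window `W`
has `(Δ_σ, Δ_ε) ∈ R` — the windowed enclosure `IsingEnclosure W R` stated over the LARGER (and provably
non-empty) class `SatisfiesSigmaAxioms`. [cite: RattazziEtAl2008, §5] -/
def SigmaIsingEnclosure (W R : Set (ℝ × ℝ)) : Prop :=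
  ∀ D : SigmaEpsilonData, D.SatisfiesSigmaAxioms → (D.Δσ, D.Δε) ∈ W → (D.Δσ, D.Δε) ∈ R

/-- A σ-enclosure is an enclosure (`IsingEnclosure`, over `SatisfiesBootstrapAxioms`). Elementary. [folklore] -/
theorem SigmaIsingEnclosure.isingEnclosure {W R : Set (ℝ × ℝ)} (h : SigmaIsingEnclosure W R) :
    IsingEnclosure W R :=
  fun D hD hW => h D hD.sigmaAxioms hW

/-- Monotonicity: a smaller window and a larger region. Elementary. [folklore] -/
theorem SigmaIsingEnclosure.mono {W W' R R' : Set (ℝ × ℝ)} (h : SigmaIsingEnclosure W R) (hW : W' ⊆ W)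
    (hR : R ⊆ R') : SigmaIsingEnclosure W' R' :=
  fun D hD hmem => hR (h D hD (hW hmem))

/-- A σ-excluded box is a σ-enclosure with empty region. Elementary. [folklore] -/
theorem SigmaBoxExcluded.sigmaIsingEnclosure {Q : Set (ℝ × ℝ)} (h : SigmaBoxExcluded Q) :
    SigmaIsingEnclosure Q ∅ :=
  fun D hD hmem => (h D hD hmem).elim

/-- Assembly: if `W ⊆ R ∪ ⋃ᵢ Qᵢ` and every `Qᵢ` is σ-excluded then `SigmaIsingEnclosure W R` (the σ-version of
`isingEnclosure_of_cover`). Elementary. [folklore] -/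
theorem sigmaIsingEnclosure_of_cover {ι : Type*} {W R : Set (ℝ × ℝ)} (Q : ι → Set (ℝ × ℝ))
    (hcov : W ⊆ R ∪ ⋃ i, Q i) (hQ : ∀ i, SigmaBoxExcluded (Q i)) : SigmaIsingEnclosure W R := by
  intro D hD hmem
  rcases hcov hmem with hR | hQ'
  · exact hR
  · obtain ⟨i, hi⟩ := Set.mem_iUnion.mp hQ'
    exact ((hQ i) D hD hi).elim

/-- **Sanity constraint on σ-enclosures**: if the window contains the free point `(1/2, 1)` then so does the
region — no assembly of single-correlator certificates can carve the free scalar out of its window.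
[cite: ElShowkEtAl2012, §5] -/
theorem SigmaIsingEnclosure.half_one_mem {W R : Set (ℝ × ℝ)} (h : SigmaIsingEnclosure W R)
    (hW : ((1 : ℝ) / 2, (1 : ℝ)) ∈ W) : ((1 : ℝ) / 2, (1 : ℝ)) ∈ R :=
  h freeScalarData freeScalarData_satisfiesSigmaAxioms hW

/-- Contrapositive form: a box containing the free point is not σ-excluded. [cite: ElShowkEtAl2012, §5] -/
theorem not_sigmaBoxExcluded_of_half_one_mem {Q : Set (ℝ × ℝ)} (hQ : ((1 : ℝ) / 2, (1 : ℝ)) ∈ Q) :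
    ¬ SigmaBoxExcluded Q :=
  fun h => h.half_one_not_mem hQ

end Literature.MathematicalPhysics.QuantumFieldTheory.ConformalBootstrap3D
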